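import Literature.Analysis.FluidPDE.SteadyLiouvilleCriteriaProofs
import Literature.Analysis.FluidPDE.SteadyHeadPressureMaximumPrinciple
import Literature.Analysis.FluidPDE.AncientMildCurlCompactness
import Literature.Analysis.FluidPDE.SteadyNSBoundedMild
import Literature.Analysis.FluidPDE.NewtonKernel
import Literature.Analysis.FluidPDE.LipschitzSqIntegrableDecay
import Literature.Analysis.FluidPDE.EnstrophySplitting
import HarnessLib

/-!
# The pressure of a steady `D`-solution on `ℝ³` decaying at infinity has a limit at infinity
# (Galdi 2011, Thm X.5.1 / Wang 2025, Thm 2.1 — the order-zero pressure clause, PROVED)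

Analysis/FluidPDE proofs file (theorems only: no definitions, no named facts). The tree's named
fact `wang2025_thm21_DSolution_uniformDecay` (`SteadyDSolutionAsymptotics.lean`; W. Wang 2025,
Thm 2.1 = G. P. Galdi 2011, Thm X.5.1: all derivatives of a `D`-solution `u` on `ℝ³` and of its
pressure `p − p₁` tend to `0` at infinity) is consumed by the steady Liouville lines
(`GaldiLiouvilleGate` «cylinder budgets», items stmt-NavierStokesRegularity-0895 and -0896) ONLY through
its order-zero pressure clause under the decay hypothesis `u → 0` of Leray's problem
(`exists_tendsto_pressure_of_tendsto_zero`, `pressureLimit_of_uniformDecay`,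
`headMaximumPrinciple_of_uniformDecay`, all conditional on the fact). This file PROVES that clause:

* `IsDSolution.exists_tendsto_pressure` — for `ν > 0`, a classical steady solution `(u, p)` of
  `−νΔu + (u·∇)u + ∇p = 0`, `div u = 0` on `ℝ³` (`u ∈ C²`, `p ∈ C¹`) with finite Dirichlet
  integral and `u → 0` at infinity has a pressure limit: `∃ c, p → c` at infinity;
* `pressureLimit_of_tendsto_zero`, `headMaximumPrinciple_of_tendsto_zero` — the two statements
  `pressureLimit_of_uniformDecay` / `headMaximumPrinciple_of_uniformDecay` of
  `SteadyHeadPressureMaximumPrinciple.lean` WITHOUT the hypothesis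
  `(hfact : wang2025_thm21_DSolution_uniformDecay)` (same conclusions, letter for letter).

## The printed proof and its formalisation

Wang 2025, §2.1.3 (pp. 30–31) / Galdi 2011, proof of Thm X.5.1: the velocity is smooth and, by the
Stokes estimates, has bounded (indeed decaying) derivatives; the pressure is, up to a constant, the
Calderón–Zygmund pressure `RᵢRⱼ(uᵢuⱼ) ∈ L³(ℝ³)` ("再由 `∇p ∈ L²(ℝ³)` 和 `∇²p ∈ L²(ℝ³)`, 存在一个常数
`p₁` 使得 `lim_{|x|→∞} |p(x) − p₁| = 0`"); an `L^q`-function with bounded gradient tends to `0` at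
infinity. Every analytic input is already PROVED in the tree, and this file assembles them:

1. smoothness `u ∈ C^∞` of `C²` steady solutions (`IsLerayProfile.contDiff_velocity_infty`,
   `LerayProfileRegularity.lean`, the `H^s`-bootstrap), whence `p ∈ C^∞` (`∇p = νΔu − (u·∇)u`);
2. `u → 0` and `∫|∇u|² < ∞` give `u ∈ L⁶` (`memLp_six_of_isDSolution_of_tendsto_zero`,
   Galdi Thm II.6.1) and `u` bounded;
3. the Calderón–Zygmund pressure `Q ∈ L³`, `−ΔQ = ∂ᵢ∂ⱼ(uᵢuⱼ)` weakly
   (`nrs1996_rieszPressure_holds`, `q = 3`), and the Liouville step `p − Q = c` a.e.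
   (`IsLerayProfile.exists_sub_ae_eq_const_six`, this file: Tsai's fixed-scale estimate
   `IsLerayProfile.abs_fderiv_normed_convolution_sub_le` with the ball bounds from
   `u ∈ L⁶ ∩ L^∞ ⊂ L^{15/2}` and `Q ∈ L³`, exactly as the tree's `…_nineHalves` twin for Galdi's
   Thm X.9.5);
4. bounded steady flows are Oseen-mild (`IsSteadyClassicalNS.eq_heatExtension_sub_oseenDuhamel`,
   KNSS 2009 Lemma 3.1) and KNSS's bounds (4.10) on all spatial derivatives of bounded mild
   solutions (`exists_iteratedFDeriv_bound_of_bounded_oseenMild`) bound `Du`, `D²u`, hence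
   `∇p = νΔu − (u·∇)u` is bounded and `p` is Lipschitz;
5. a Lipschitz function with `∫|p − c|³ < ∞` tends to `0` at infinity
   (`tendsto_cocompact_of_lipschitzWith_of_integrable_pow`, the `L^q` twin of the tree's
   `tendsto_cocompact_of_lipschitzWith_of_integrable_sq`).

What is NOT here: the order-zero VELOCITY clause of Thm 2.1 without the decay hypothesis
(`u ∈ L⁶ ⇒ u → 0`, Wang p. 30, local Stokes representation (2.4) + Hardy), and hence the named fact
itself; the higher-order clauses are in the sibling file `SteadyDSolutionDerivativeDecay.lean`
(conditional only on that order-zero velocity clause).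

## References

* W. Wang (王文栋), *稳态Navier–Stokes方程的Liouville定理*, Science Press (2025), Thm 2.1 (p. 28),
  proof §2.1.3 (pp. 30–31) (held `book:anonnd-navier-stokesliouville`, chunks p0028–p0031). [Wang2025]
* G. P. Galdi, *An Introduction to the Mathematical Theory of the Navier–Stokes Equations.
  Steady-State Problems*, 2nd ed., Springer (2011), Thm X.5.1, Thm X.9.5 (proof: identification of
  the pressure), Thm II.6.1. [Galdi2011]
* G. Koch, N. Nadirashvili, G. Seregin, V. Šverák, Acta Math. 203 (2009) = arXiv:0709.3599, §3
  Lemma 3.1, §4 (4.10). [KochNadirashviliSereginSverak2009]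
* J. Nečas, M. Růžička, V. Šverák, Acta Math. 176 (1996), Lemma 3.1. [NecasRuzickaSverak1996]
* T.-P. Tsai, ARMA 143 (1998), Lemma 2.1. [Tsai1998]
-/

noncomputable section

open MeasureTheory Set Filter Metric Topology InnerProductSpace Function ContinuousLinearMap
open scoped ENNReal NNReal RealInnerProductSpace ContDiff Laplacian Convolution

namespace Literature.Analysis.FluidPDE

open UnboundedOperators (heatKernel heatExtension)

/-! ## §1. A Lipschitz map with an integrable power of its norm vanishes at infinity -/

section Tail

variable {E : Type*} [NormedAddCommGroup E] [InnerProductSpace ℝ E] [FiniteDimensional ℝ E]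
  [MeasurableSpace E] [BorelSpace E]
variable {F : Type*} [NormedAddCommGroup F]

/-- **A Lipschitz map with `∫ ‖v‖^q < ∞` vanishes at infinity** (`q` a natural number; for `q = 0`
the hypothesis forces `E` to have finite measure, i.e. to be trivial): were
`‖v(x₀)‖ ≥ ε`, then `‖v‖ ≥ ε/2` on `B(x₀, r)`, `r = ε/(2L+2)`, so
`∫_{B(x₀,r)} ‖v‖^q ≥ (ε/2)^q |B(0, r)| > 0`, which fails for `x₀` large since the tails
`∫_{B(x₀,r)} ‖v‖^q` of an integrable function tend to `0` (`tendsto_setIntegral_ball_cocompact`).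
The `L^q` twin of the tree's `tendsto_cocompact_of_lipschitzWith_of_integrable_sq`. [folklore] -/
private theorem tendsto_cocompact_of_lipschitzWith_of_integrable_pow {v : E → F} {L : ℝ≥0} {q : ℕ}
    (hL : LipschitzWith L v) (hint : Integrable fun x => ‖v x‖ ^ q) :
    Tendsto v (cocompact E) (𝓝 0) := by
  rcases subsingleton_or_nontrivial E with hE | hE
  · have : cocompact E = ⊥ := by
      haveI : CompactSpace E := ⟨Subsingleton.isCompact (s := (univ : Set E)) (subsingleton_univ)⟩
      exact cocompact_eq_bot
    rw [this]
    exact tendsto_bot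
  rw [Metric.tendsto_nhds]
  intro ε hε
  set r : ℝ := ε / (2 * L + 2) with hr
  have hr0 : 0 < r := by positivity
  set m : ℝ := (ε / 2) ^ q * (volume (ball (0 : E) r)).toReal with hm
  have hvol : 0 < (volume (ball (0 : E) r)).toReal :=
    ENNReal.toReal_pos (measure_ball_pos volume 0 hr0).ne' measure_ball_lt_top.ne
  have hm0 : 0 < m := by positivity
  have htail := (Metric.tendsto_nhds.1 (tendsto_setIntegral_ball_cocompact hint r)) m hm0
  filter_upwards [htail] with x₀ hx₀
  rw [dist_zero_right]
  by_contra hge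
  rw [not_lt] at hge
  have hlow : ∀ x ∈ ball x₀ r, (ε / 2) ^ q ≤ ‖v x‖ ^ q := by
    intro x hx
    have h1 : ‖v x₀ - v x‖ ≤ L * r := by
      calc ‖v x₀ - v x‖ = dist (v x₀) (v x) := (dist_eq_norm _ _).symm
        _ ≤ L * dist x₀ x := hL.dist_le_mul x₀ x
        _ ≤ L * r := by
            refine mul_le_mul_of_nonneg_left ?_ L.coe_nonneg
            rw [dist_comm]; exact (mem_ball.1 hx).le
    have h2 : (L : ℝ) * r ≤ ε / 2 := by
      rw [hr, mul_div_assoc']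
      rw [div_le_div_iff₀ (by positivity) (by positivity)]
      nlinarith [L.coe_nonneg, hε]
    have h3 : ε / 2 ≤ ‖v x‖ := by
      have := norm_sub_norm_le (v x₀) (v x)
      linarith
    exact pow_le_pow_left₀ (by positivity) h3 q
  have hI : m ≤ ∫ x in ball x₀ r, ‖v x‖ ^ q := by
    have h1 : ∫ _ in ball x₀ r, (ε / 2) ^ q ≤ ∫ x in ball x₀ r, ‖v x‖ ^ q :=
      setIntegral_mono_on (integrableOn_const measure_ball_lt_top.ne) hint.integrableOn
        measurableSet_ball hlow
    rw [setIntegral_const, smul_eq_mul] at h1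
    have hv : volume.real (ball x₀ r) = (volume (ball (0 : E) r)).toReal := by
      rw [measureReal_def, Measure.addHaar_ball_center]
    rw [hv] at h1
    rw [hm, mul_comm]
    exact h1
  have hI' : |(∫ x in ball x₀ r, ‖v x‖ ^ q) - 0| < m := by simpa [Real.dist_eq] using hx₀
  rw [sub_zero, abs_of_nonneg (integral_nonneg fun x => pow_nonneg (norm_nonneg _) _)] at hI'
  linarith

end Tail

/-! ## §2. Steady solutions as Leray profiles at rate `0`; smoothness of velocity and pressure -/

section Smooth

variable {E : Type*} [NormedAddCommGroup E] [InnerProductSpace ℝ E] [FiniteDimensional ℝ E]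

/-- **An unforced steady solution is a Leray profile at rate `a = 0`**: the profile system
`−νΔU + aU + a(y·∇)U + (U·∇)U + ∇P = 0`, `div U = 0` at `a = 0` is the steady system
`−νΔU + (U·∇)U + ∇P = 0` (converse of `IsLerayProfile.isSteadyNSSolution_zero`): Wang's system
(0.1) is NRŠ's profile system (1.4)–(1.5) at `a = 0`. [cite: Wang2025, (0.1) p. 1] -/
theorem IsSteadyNSSolution.isLerayProfile_zero {ν : ℝ} {U : E → E} {P : E → ℝ}
    (h : IsSteadyNSSolution ν 0 U P) : IsLerayProfile ν 0 U P where
  contDiff_velocity := h.contDiff_velocity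
  contDiff_pressure := h.contDiff_pressure
  profile_eq y := by
    have e := h.momentum y
    simp only [Pi.zero_apply] at e
    simp only [zero_smul, add_zero]
    exact e
  divFree := h.divFree

/-- **Steady `C²` solutions on `ℝ³` are smooth** (Galdi 2011, Thm X.1.1; Wang 2025, p. 28:
"众所周知, (0.1) 的弱解属于 `W^{1,2}_{loc}(ℝ³)` 实际上是光滑的"): for `ν ≠ 0`, a classical steady
solution `(u, p)` of the unforced system on `ℝ³` has `u ∈ C^∞` — the tree's `H^s`-bootstrap for
Leray profiles (`IsLerayProfile.contDiff_velocity_infty`) at rate `0`. [cite: Wang2025, p. 28 (before Thm 2.1)] -/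
theorem IsSteadyNSSolution.contDiff_velocity_infty {ν : ℝ}
    {u : EuclideanSpace ℝ (Fin 3) → EuclideanSpace ℝ (Fin 3)} {p : EuclideanSpace ℝ (Fin 3) → ℝ}
    (h : IsSteadyNSSolution ν 0 u p) (hν : ν ≠ 0) : ContDiff ℝ ∞ u :=
  h.isLerayProfile_zero.contDiff_velocity_infty hν (by simp)

/-- **The pressure of a steady `C²` solution on `ℝ³` is smooth**: `∇p = νΔu − (u·∇)u` is smooth
since `u` is (`IsSteadyNSSolution.contDiff_velocity_infty`), and a differentiable function with
smooth derivative is smooth. [cite: Wang2025, p. 28 (before Thm 2.1)] -/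
theorem IsSteadyNSSolution.contDiff_pressure_infty {ν : ℝ}
    {u : EuclideanSpace ℝ (Fin 3) → EuclideanSpace ℝ (Fin 3)} {p : EuclideanSpace ℝ (Fin 3) → ℝ}
    (h : IsSteadyNSSolution ν 0 u p) (hν : ν ≠ 0) : ContDiff ℝ ∞ p := by
  have hu := h.contDiff_velocity_infty hν
  have hpd : Differentiable ℝ p := h.contDiff_pressure.differentiable one_ne_zero
  -- `∇p = νΔu − (u·∇)u` is smooth
  have hΔ : ContDiff ℝ ∞ (Δ u) := by
    have : ContDiff ℝ ((⊤ : ℕ∞) + 2 : ℕ∞) u := by simpa using hu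
    exact contDiff_laplacian this
  have hconv : ContDiff ℝ ∞ (convect u u) := by
    have h1 : ContDiff ℝ ∞ (fderiv ℝ u) := hu.fderiv_right (m := ∞) (by simp)
    have : convect u u = fun x => fderiv ℝ u x (u x) := rfl
    rw [this]
    exact h1.clm_apply hu
  have hgrad : gradient p = fun x => ν • (Δ u) x - convect u u x := by
    funext x
    have h0 := h.momentum x
    simp only [Pi.zero_apply] at h0
    rw [← sub_eq_zero, ← h0]
    abel
  have hgradC : ContDiff ℝ ∞ (gradient p) := by
    rw [hgrad]
    exact (hΔ.const_smul ν).sub hconv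
  -- `fderiv p = toDual ∘ gradient p`
  have hfd : fderiv ℝ p = fun x => (InnerProductSpace.toDual ℝ (EuclideanSpace ℝ (Fin 3))) (gradient p x) := by
    funext x
    rw [gradient, LinearIsometryEquiv.apply_symm_apply]
  have hfdC : ContDiff ℝ ∞ (fderiv ℝ p) := by
    rw [hfd]
    exact (InnerProductSpace.toDual ℝ (EuclideanSpace ℝ (Fin 3))).contDiff.comp hgradC
  exact contDiff_infty_iff_fderiv.2 ⟨hpd, hfdC⟩

/-- A steady `C²` solution of the unforced system at unit viscosity on `ℝ³` is a steady classical
(`C^∞`) solution in the sense of `IsSteadyClassicalNS 1 0 u p` (`SteadyStrainedNS.lean`):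
smoothness by the two previous lemmas ("众所周知 … 实际上是光滑的"), and `(u·∇)u = Δu − ∇p`.
[cite: Wang2025, p. 28 (before Thm 2.1)] -/
theorem IsSteadyNSSolution.isSteadyClassicalNS_one
    {u : EuclideanSpace ℝ (Fin 3) → EuclideanSpace ℝ (Fin 3)} {p : EuclideanSpace ℝ (Fin 3) → ℝ}
    (h : IsSteadyNSSolution 1 0 u p) : IsSteadyClassicalNS 1 0 u p where
  smooth_velocity := h.contDiff_velocity_infty one_ne_zero
  smooth_pressure := h.contDiff_pressure_infty one_ne_zero
  momentum x := by
    have h0 : -((1 : ℝ) • (Δ u) x) + convect u u x + gradient p x = 0 := by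
      have e := h.momentum x
      rwa [Pi.zero_apply] at e
    rw [← sub_eq_zero, ← h0, Pi.zero_apply, add_zero]
    abel
  divFree := h.divFree

end Smooth

/-! ## §3. Bounded steady flows: uniform bounds on all derivatives (KNSS 2009, (4.10)) -/

section DerivativeBounds

/-- **All derivatives of a bounded steady flow are bounded** (Koch–Nadirashvili–Seregin–Šverák
2009, (4.10) with Lemma 3.1, applied to the time-independent bounded mild solution `u(t) = W`): a
steady classical solution `(W, P)` of the unforced system at unit viscosity on `ℝ³` with `‖W‖ ≤ M`
has `‖DᵏW‖ ≤ K_k` on `ℝ³` for every `k`. The steady field is Oseen-mild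
(`IsSteadyClassicalNS.eq_heatExtension_sub_oseenDuhamel`, with the initial time shifted by
`oseenDuhamel_translate`), and KNSS's window-uniform bounds for bounded Oseen-mild fields
(`exists_iteratedFDeriv_bound_of_bounded_oseenMild`) apply on the window `(−2, 0)` at `t = −½`.
[cite: KochNadirashviliSereginSverak2009, §4 (4.10) with §3 Lemma 3.1 (arXiv:0709.3599 p. 8)] -/
theorem IsSteadyClassicalNS.exists_norm_iteratedFDeriv_le_of_bounded
    {W : EuclideanSpace ℝ (Fin 3) → EuclideanSpace ℝ (Fin 3)} {P : EuclideanSpace ℝ (Fin 3) → ℝ}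
    (h : IsSteadyClassicalNS 1 0 W P) {M : ℝ} (hM : ∀ x, ‖W x‖ ≤ M) (k : ℕ) :
    ∃ K : ℝ, ∀ x, ‖iteratedFDeriv ℝ k W x‖ ≤ K := by
  obtain ⟨K, hK⟩ := exists_iteratedFDeriv_bound_of_bounded_oseenMild M k
  have hWc : Continuous W := h.smooth_velocity.continuous
  have hc : ContinuousOn (uncurry (fun _ : ℝ => W)) (Ioo (-2 : ℝ) 0 ×ˢ univ) :=
    (hWc.comp continuous_snd).continuousOn
  have hdiv : ∀ t ∈ Ioo (-2 : ℝ) 0, IsWeaklyDivFree ((fun _ : ℝ => W) t) := fun t _ =>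
    VectorCalculus.IsDivFree.isWeaklyDivFree_holds h.divFree
      (h.smooth_velocity.of_le (by exact_mod_cast le_top))
  have hmild : ∀ s t : ℝ, (-2 : ℝ) < s → s < t → t < 0 → ∀ x,
      (fun _ : ℝ => W) t x = heatExtension ((fun _ : ℝ => W) s) (t - s) x -
        oseenDuhamel 1 s (fun _ : ℝ => W) (fun _ : ℝ => W) t x := by
    intro s t _ hst _ x
    have hτ : 0 < t - s := sub_pos.2 hst
    have e := h.eq_heatExtension_sub_oseenDuhamel hM hτ x
    have hshift := oseenDuhamel_translate 1 0 s (fun _ : ℝ => W) (fun _ : ℝ => W) (t - s) x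
    rw [zero_add, sub_add_cancel] at hshift
    show W x = heatExtension W (t - s) x - oseenDuhamel 1 s (fun _ : ℝ => W) (fun _ : ℝ => W) t x
    rw [← hshift]
    exact e
  have hbd : ∀ t ∈ Ioo (-2 : ℝ) 0, ∀ x, ‖(fun _ : ℝ => W) t x‖ ≤ M := fun _ _ x => hM x
  have h1 := hK hc hdiv hmild hbd (-1 / 2) (by norm_num) (by norm_num)
  exact ⟨K, fun x => h1.2 x⟩

/-- The derivative bounds for a steady `C²` solution of the unforced system at unit viscosity on
`ℝ³` which tends to `0` at infinity: it is smooth (`IsSteadyNSSolution.isSteadyClassicalNS_one`),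
bounded (`exists_forall_norm_le_of_tendsto_cocompact`), hence `‖Dᵏu‖ ≤ K_k` for every `k`
(`IsSteadyClassicalNS.exists_norm_iteratedFDeriv_le_of_bounded`). [cite: KochNadirashviliSereginSverak2009, §4 (4.10) with §3 Lemma 3.1 (arXiv:0709.3599 p. 8)] -/
theorem IsSteadyNSSolution.exists_norm_iteratedFDeriv_le_of_tendsto_zero
    {u : EuclideanSpace ℝ (Fin 3) → EuclideanSpace ℝ (Fin 3)} {p : EuclideanSpace ℝ (Fin 3) → ℝ}
    (h : IsSteadyNSSolution 1 0 u p)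
    (hdec : Tendsto u (cocompact (EuclideanSpace ℝ (Fin 3))) (𝓝 0)) (k : ℕ) :
    ∃ K : ℝ, ∀ x, ‖iteratedFDeriv ℝ k u x‖ ≤ K := by
  obtain ⟨M, hM⟩ := exists_forall_norm_le_of_tendsto_cocompact h.contDiff_velocity.continuous hdec
  exact h.isSteadyClassicalNS_one.exists_norm_iteratedFDeriv_le_of_bounded hM k

end DerivativeBounds

/-! ## §4. The Liouville step for the pressure: `P − Q` is constant when `U ∈ L⁶ ∩ L^∞`, `Q ∈ L³` -/

section PressureConstancy

open TopologicalSpace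

variable {ν a : ℝ} {U : EuclideanSpace ℝ (Fin 3) → EuclideanSpace ℝ (Fin 3)}
  {P : EuclideanSpace ℝ (Fin 3) → ℝ}

/-- A bounded field with `∫ |U|⁶ < ∞` has `∫ |U|^{15/2} < ∞`. [folklore] -/
private theorem lintegral_rpow_fifteenHalves_ne_top_of_six {M : ℝ}
    (hM : ∀ x, ‖U x‖ ≤ M) (hIU : ∫⁻ y, ‖U y‖ₑ ^ (6 : ℝ) ≠ ⊤) :
    ∫⁻ y, ‖U y‖ₑ ^ (15 / 2 : ℝ) ≠ ⊤ := by
  have hM0 : 0 ≤ M := (norm_nonneg _).trans (hM 0)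
  have hpt : ∀ y, ‖U y‖ₑ ^ (15 / 2 : ℝ) ≤ ENNReal.ofReal M ^ (3 / 2 : ℝ) * ‖U y‖ₑ ^ (6 : ℝ) := by
    intro y
    have hsplit : ‖U y‖ₑ ^ (15 / 2 : ℝ) = ‖U y‖ₑ ^ (3 / 2 : ℝ) * ‖U y‖ₑ ^ (6 : ℝ) := by
      rw [← ENNReal.rpow_add_of_nonneg _ _ (by norm_num) (by norm_num)]
      norm_num
    rw [hsplit]
    refine mul_le_mul' (ENNReal.rpow_le_rpow ?_ (by norm_num)) le_rfl
    rw [← ofReal_norm]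
    exact ENNReal.ofReal_le_ofReal (hM y)
  refine ne_top_of_le_ne_top ?_ (lintegral_mono hpt)
  rw [lintegral_const_mul' _ _ (ENNReal.rpow_ne_top_of_nonneg (by norm_num) ENNReal.ofReal_ne_top)]
  exact ENNReal.mul_ne_top (ENNReal.rpow_ne_top_of_nonneg (by norm_num) ENNReal.ofReal_ne_top) hIU

/-- **The Liouville step for `U ∈ L⁶ ∩ L^∞`: mollifications of `P − Q` have zero gradient**
(Galdi 2011, proof of Thm X.5.1 / X.9.5: the pressure of a `D`-solution is, up to a constant, the
Calderón–Zygmund pressure `RᵢRⱼ(UᵢUⱼ)`; the argument is NRŠ 1996, proof of Lemma 3.1 / Tsai 1998,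
Lemma 2.1). Let `(U, P)` be a Leray profile with `U` bounded and `∫ |U|⁶ < ∞`, and let `Q ∈ L³`
solve `−ΔQ = ∂ᵢ∂ⱼ(UᵢUⱼ)` in `𝒟'(ℝ³)`. Then `ψ ⋆ (P − Q)` has vanishing gradient for every bump `ψ`:
Tsai's fixed-scale estimate `IsLerayProfile.abs_fderiv_normed_convolution_sub_le` applies with the
ball bounds `∫_{B_ϱ}|U| ≲ ϱ^{13/5}`, `∫_{B_ϱ}|U|² ≲ ϱ^{11/5}` (Hölder with `U ∈ L^{15/2}`) and
`∫_{B_ϱ}|Q| ≲ ϱ^{11/5}` (Hölder with `Q ∈ L³` for `ϱ ≥ 1`, `ϱ² ≤ ϱ^{11/5}`; for `ϱ ≤ 1` the interior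
estimate for the weakly harmonic `P − Q` bounds `Q` a.e. near the origin), and `R → ∞`. Twin of the
tree's `…_nineHalves` version. [cite: Galdi2011, Thm X.9.5 (proof); NecasRuzickaSverak1996, Lemma 3.1 proof (pp. 287–288)] -/
theorem IsLerayProfile.fderiv_normed_convolution_sub_eq_zero_six (hprof : IsLerayProfile ν a U P)
    {M : ℝ} (hM : ∀ x, ‖U x‖ ≤ M) (hIU : ∫⁻ y, ‖U y‖ₑ ^ (6 : ℝ) ≠ ⊤)
    {Q : EuclideanSpace ℝ (Fin 3) → ℝ} (hQm : AEStronglyMeasurable Q volume)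
    (hIQ : ∫⁻ y, ‖Q y‖ₑ ^ (3 : ℝ) ≠ ⊤)
    (hQ : ∀ φ : EuclideanSpace ℝ (Fin 3) → ℝ, ContDiff ℝ (⊤ : ℕ∞) φ → HasCompactSupport φ →
      ∫ y, Q y * (Δ φ) y = -∫ y, fderiv ℝ (fderiv ℝ φ) y (U y) (U y))
    (ψ : ContDiffBump (0 : EuclideanSpace ℝ (Fin 3))) (y e : EuclideanSpace ℝ (Fin 3)) :
    fderiv ℝ (ψ.normed volume ⋆[lsmul ℝ ℝ, volume] fun x => P x - Q x) y e = 0 := by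
  -- exponents and basic regularity
  have hpq₁ : (15 / 2 : ℝ).HolderConjugate (15 / 13) := ⟨by norm_num, by norm_num, by norm_num⟩
  have hpq₂ : (15 / 4 : ℝ).HolderConjugate (15 / 11) := ⟨by norm_num, by norm_num, by norm_num⟩
  have hpq₃ : (3 : ℝ).HolderConjugate (3 / 2) := ⟨by norm_num, by norm_num, by norm_num⟩
  have hU1 : ContDiff ℝ 1 U := hprof.contDiff_velocity.of_le one_le_two
  have hP1 := hprof.contDiff_pressure
  have hUm : AEStronglyMeasurable U volume := hU1.continuous.aestronglyMeasurable
  have hU2m : AEStronglyMeasurable (fun x => ‖U x‖ ^ 2) volume :=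
    (hU1.continuous.norm.pow 2).aestronglyMeasurable
  have hIU15 : ∫⁻ y, ‖U y‖ₑ ^ (15 / 2 : ℝ) ≠ ⊤ := lintegral_rpow_fifteenHalves_ne_top_of_six hM hIU
  have hIU2 : ∫⁻ x, ‖(‖U x‖ ^ 2)‖ₑ ^ (15 / 4 : ℝ) ≠ ⊤ := by
    have h : ∀ x, ‖(‖U x‖ ^ 2)‖ₑ ^ (15 / 4 : ℝ) = ‖U x‖ₑ ^ (15 / 2 : ℝ) := fun x => by
      rw [Real.enorm_eq_ofReal (sq_nonneg _), ENNReal.ofReal_pow (norm_nonneg _), ofReal_norm,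
        ← ENNReal.rpow_natCast, ← ENNReal.rpow_mul]
      norm_num
    simp_rw [h]
    exact hIU15
  -- the ball bounds for `U` and `|U|²` (Hölder with `U ∈ L^{15/2}`)
  have hballU : ∀ ϱ : ℝ, 0 < ϱ → IntegrableOn U (closedBall (0 : EuclideanSpace ℝ (Fin 3)) ϱ) ∧
      ∫ x in closedBall (0 : EuclideanSpace ℝ (Fin 3)) ϱ, ‖U x‖ ≤
        ((∫⁻ x, ‖U x‖ₑ ^ (15 / 2 : ℝ)) ^ (1 / (15 / 2 : ℝ)) *
          volume (ball (0 : EuclideanSpace ℝ (Fin 3)) 1) ^ (1 / (15 / 13 : ℝ))).toReal *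
          ϱ ^ (13 / 5 : ℝ) := fun ϱ hϱ => by
    have h := setIntegral_norm_closedBall_le_holder hUm hpq₁ hIU15 hϱ
    exact ⟨h.1, h.2.trans_eq (by norm_num)⟩
  have hballU2 : ∀ ϱ : ℝ, 0 < ϱ →
      IntegrableOn (fun x => ‖U x‖ ^ 2) (closedBall (0 : EuclideanSpace ℝ (Fin 3)) ϱ) ∧
      ∫ x in closedBall (0 : EuclideanSpace ℝ (Fin 3)) ϱ, ‖(‖U x‖ ^ 2)‖ ≤
        ((∫⁻ x, ‖(‖U x‖ ^ 2)‖ₑ ^ (15 / 4 : ℝ)) ^ (1 / (15 / 4 : ℝ)) *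
          volume (ball (0 : EuclideanSpace ℝ (Fin 3)) 1) ^ (1 / (15 / 11 : ℝ))).toReal *
          ϱ ^ (11 / 5 : ℝ) := fun ϱ hϱ => by
    have h := setIntegral_norm_closedBall_le_holder hU2m hpq₂ hIU2 hϱ
    exact ⟨h.1, h.2.trans_eq (by norm_num)⟩
  -- `P - Q` is weakly harmonic
  have hQl : LocallyIntegrable Q volume := locallyIntegrable_of_holder hQm hpq₃ hIQ
  have hgl : LocallyIntegrable (fun x => P x - Q x) volume :=
    hP1.continuous.locallyIntegrable.sub hQl
  have hharm : ∀ φ : EuclideanSpace ℝ (Fin 3) → ℝ, ContDiff ℝ (⊤ : ℕ∞) φ → HasCompactSupport φ →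
      ∫ x, (P x - Q x) * (Δ φ) x = 0 := by
    intro φ hφ hφc
    have hΔc : Continuous (Δ φ) := FluidPDE.continuous_laplacian (contDiff_infty.1 hφ 2)
    have hΔs : HasCompactSupport (Δ φ) :=
      hφc.mono' fun x hx => by
        contrapose! hx
        simp [FluidPDE.laplacian_eq_zero_of_notMem_tsupport hx]
    have i1 : Integrable fun x => P x * (Δ φ) x :=
      (hP1.continuous.mul hΔc).integrable_of_hasCompactSupport hΔs.mul_left
    have i2 : Integrable fun x => Q x * (Δ φ) x := by
      simpa only [smul_eq_mul] using hQl.integrable_smul_right_of_hasCompactSupport hΔc hΔs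
    simp_rw [sub_mul]
    rw [integral_sub i1 i2, hprof.integral_pressure_mul_laplacian_eq_neg_integral_hessian hφ hφc,
      hQ φ hφ hφc, sub_self]
  -- the ball bound for `Q`: Hölder for `ϱ ≥ 1`, the interior estimate for `ϱ ≤ 1`
  set AQ₁ : ℝ := ((∫⁻ x, ‖Q x‖ₑ ^ (3 : ℝ)) ^ (1 / (3 : ℝ)) *
    volume (ball (0 : EuclideanSpace ℝ (Fin 3)) 1) ^ (1 / (3 / 2 : ℝ))).toReal with hAQ₁_def
  have hAQ₁0 : 0 ≤ AQ₁ := ENNReal.toReal_nonneg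
  have hballQ₁ : ∀ ϱ : ℝ, 0 < ϱ → IntegrableOn Q (closedBall (0 : EuclideanSpace ℝ (Fin 3)) ϱ) ∧
      ∫ x in closedBall (0 : EuclideanSpace ℝ (Fin 3)) ϱ, ‖Q x‖ ≤ AQ₁ * ϱ ^ (2 : ℝ) :=
      fun ϱ hϱ => by
    have h := setIntegral_norm_closedBall_le_holder hQm hpq₃ hIQ hϱ
    exact ⟨h.1, h.2.trans_eq (by rw [hAQ₁_def]; norm_num)⟩
  obtain ⟨Cw, hCw0, hCw⟩ := exists_const_ae_abs_le_integral_of_weaklyHarmonic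
  have hint4 : IntegrableOn (fun x => P x - Q x) (ball (0 : EuclideanSpace ℝ (Fin 3)) 4) volume :=
    (hgl.integrableOn_isCompact (isCompact_closedBall 0 4)).mono_set ball_subset_closedBall
  set K : ℝ := Cw * ((4 : ℝ) ^ 3)⁻¹ * ∫ x in ball (0 : EuclideanSpace ℝ (Fin 3)) 4, |P x - Q x|
    with hK_def
  have hK0 : 0 ≤ K := by
    rw [hK_def]
    exact mul_nonneg (by positivity) (integral_nonneg fun x => abs_nonneg _)
  have hae : ∀ᵐ x ∂(volume.restrict (ball (0 : EuclideanSpace ℝ (Fin 3)) 2)), |P x - Q x| ≤ K := by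
    have h := hCw (fun x => P x - Q x) 0 4 (by norm_num) hint4
      (fun φ hφ hφc _ => hharm φ hφ hφc)
    rw [show (4 : ℝ) / 2 = 2 by norm_num] at h
    exact h
  obtain ⟨MP, hMP⟩ := (isCompact_closedBall (0 : EuclideanSpace ℝ (Fin 3)) 2).exists_bound_of_continuousOn
    hP1.continuous.continuousOn
  set MP' : ℝ := max MP 0 with hMP'_def
  have hMP'0 : 0 ≤ MP' := le_max_right _ _
  set v : ℝ := (volume : Measure (EuclideanSpace ℝ (Fin 3))).real (ball (0 : EuclideanSpace ℝ (Fin 3)) 1)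
    with hv_def
  have hv0 : 0 ≤ v := measureReal_nonneg
  set AQ : ℝ := AQ₁ + (MP' + K) * v with hAQ_def
  have hAQ0 : 0 ≤ AQ := by positivity
  have hballQ : ∀ ϱ : ℝ, 0 < ϱ → IntegrableOn Q (closedBall (0 : EuclideanSpace ℝ (Fin 3)) ϱ) ∧
      ∫ x in closedBall (0 : EuclideanSpace ℝ (Fin 3)) ϱ, ‖Q x‖ ≤ AQ * ϱ ^ (11 / 5 : ℝ) := by
    intro ϱ hϱ
    obtain ⟨hQint, hQϱ⟩ := hballQ₁ ϱ hϱ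
    refine ⟨hQint, ?_⟩
    rcases le_total ϱ 1 with hϱ1 | hϱ1
    · -- small balls: `|Q| ≤ |P| + K ≤ MP' + K` a.e. on `B̄_ϱ ⊆ B(0, 2)`
      have hsub : closedBall (0 : EuclideanSpace ℝ (Fin 3)) ϱ ⊆ ball (0 : EuclideanSpace ℝ (Fin 3)) 2 :=
        closedBall_subset_ball (by linarith)
      have hae' : ∀ᵐ x ∂(volume.restrict (closedBall (0 : EuclideanSpace ℝ (Fin 3)) ϱ)),
          ‖Q x‖ ≤ MP' + K := by
        filter_upwards [ae_restrict_of_ae_restrict_of_subset hsub hae,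
          ae_restrict_mem measurableSet_closedBall] with x hx hxmem
        have hPx : |P x| ≤ MP' :=
          (Real.norm_eq_abs _ ▸ hMP x (closedBall_subset_closedBall (by linarith) hxmem)).trans
            (le_max_left _ _)
        rw [Real.norm_eq_abs]
        calc |Q x| = |P x - (P x - Q x)| := by ring_nf
          _ ≤ |P x| + |P x - Q x| := abs_sub _ _
          _ ≤ MP' + K := add_le_add hPx hx
      have hvolϱ :
          (volume : Measure (EuclideanSpace ℝ (Fin 3))).real (closedBall (0 : EuclideanSpace ℝ (Fin 3)) ϱ) =
            ϱ ^ 3 * v := by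
        rw [Measure.addHaar_real_closedBall _ _ hϱ.le, finrank_euclideanSpace_fin]
      have hfin : volume (closedBall (0 : EuclideanSpace ℝ (Fin 3)) ϱ) < ⊤ := measure_closedBall_lt_top
      have hconst : IntegrableOn (fun _ => MP' + K) (closedBall (0 : EuclideanSpace ℝ (Fin 3)) ϱ) volume :=
        integrableOn_const hfin.ne
      have h1 : ∫ x in closedBall (0 : EuclideanSpace ℝ (Fin 3)) ϱ, ‖Q x‖ ≤
          ∫ _ in closedBall (0 : EuclideanSpace ℝ (Fin 3)) ϱ, (MP' + K) :=
        integral_mono_ae hQint.norm hconst hae'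
      rw [setIntegral_const, smul_eq_mul, hvolϱ] at h1
      have hpow : ϱ ^ 3 ≤ ϱ ^ (11 / 5 : ℝ) := by
        rw [show ϱ ^ 3 = ϱ ^ (3 : ℝ) by rw [← Real.rpow_natCast]; norm_num]
        exact Real.rpow_le_rpow_of_exponent_ge hϱ hϱ1 (by norm_num)
      calc ∫ x in closedBall (0 : EuclideanSpace ℝ (Fin 3)) ϱ, ‖Q x‖ ≤ ϱ ^ 3 * v * (MP' + K) := h1
        _ ≤ ϱ ^ (11 / 5 : ℝ) * v * (MP' + K) := by gcongr
        _ = (MP' + K) * v * ϱ ^ (11 / 5 : ℝ) := by ring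
        _ ≤ AQ * ϱ ^ (11 / 5 : ℝ) := by
            rw [hAQ_def]
            exact mul_le_mul_of_nonneg_right (le_add_of_nonneg_left hAQ₁0) (by positivity)
    · -- large balls: Hölder, `ϱ² ≤ ϱ^{11/5}`
      have hpow : ϱ ^ (2 : ℝ) ≤ ϱ ^ (11 / 5 : ℝ) :=
        Real.rpow_le_rpow_of_exponent_le hϱ1 (by norm_num)
      calc ∫ x in closedBall (0 : EuclideanSpace ℝ (Fin 3)) ϱ, ‖Q x‖ ≤ AQ₁ * ϱ ^ (2 : ℝ) := hQϱ
        _ ≤ AQ₁ * ϱ ^ (11 / 5 : ℝ) := mul_le_mul_of_nonneg_left hpow hAQ₁0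
        _ ≤ AQ * ϱ ^ (11 / 5 : ℝ) := by
            rw [hAQ_def]
            exact mul_le_mul_of_nonneg_right (le_add_of_nonneg_right (by positivity))
              (by positivity)
  -- constants and the fixed-scale estimate
  obtain ⟨⟨C₁, hC₁⟩, ⟨C₂, hC₂⟩⟩ := exists_bound_baseBump_derivs (E := (EuclideanSpace ℝ (Fin 3)))
  have hC₁0 : 0 ≤ C₁ := (norm_nonneg _).trans (hC₁ 0)
  have hC₂0 : 0 ≤ C₂ := (abs_nonneg _).trans (hC₂ 0)
  obtain ⟨K', hK'⟩ : ∃ K' : ℝ, ∀ R : ℝ, 1 ≤ R →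
      |fderiv ℝ (ψ.normed volume ⋆[lsmul ℝ ℝ, volume] fun x => P x - Q x) y e| ≤
        K' * R ^ (-(2 / 5) : ℝ) :=
    ⟨_, fun R hR => hprof.abs_fderiv_normed_convolution_sub_le hQl hharm ENNReal.toReal_nonneg
      ENNReal.toReal_nonneg hAQ0 hballU hballU2 hballQ hC₁ hC₂ hC₁0 hC₂0 ψ y e hR⟩
  -- let `R → ∞`
  have hlim : Tendsto (fun R : ℝ => K' * R ^ (-(2 / 5) : ℝ)) atTop (𝓝 0) := by
    simpa using (tendsto_rpow_neg_atTop (by norm_num : (0 : ℝ) < 2 / 5)).const_mul K'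
  have hle : |fderiv ℝ (ψ.normed volume ⋆[lsmul ℝ ℝ, volume] fun x => P x - Q x) y e| ≤ 0 :=
    ge_of_tendsto hlim (eventually_atTop.2 ⟨1, fun R hR => hK' R hR⟩)
  exact abs_nonpos_iff.1 hle

/-- **`P − Q` is a.e. constant** for a Leray profile with `U` bounded, `∫ |U|⁶ < ∞` and `Q ∈ L³`
solving the pressure Poisson equation weakly (Galdi 2011, proof of Thm X.5.1 / X.9.5: the pressure
of a `D`-solution is, up to a constant, the Calderón–Zygmund pressure `RᵢRⱼ(UᵢUⱼ) ∈ L³`; proof as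
NRŠ 1996, Lemma 3.1): every mollification of `P − Q` has zero gradient, hence is constant, and the
mollifications converge to `P − Q` a.e. [cite: Galdi2011, Thm X.9.5 (proof); NecasRuzickaSverak1996, Lemma 3.1 (p. 287)] -/
theorem IsLerayProfile.exists_sub_ae_eq_const_six (hprof : IsLerayProfile ν a U P)
    {M : ℝ} (hM : ∀ x, ‖U x‖ ≤ M) (hIU : ∫⁻ y, ‖U y‖ₑ ^ (6 : ℝ) ≠ ⊤)
    {Q : EuclideanSpace ℝ (Fin 3) → ℝ} (hQm : AEStronglyMeasurable Q volume)
    (hIQ : ∫⁻ y, ‖Q y‖ₑ ^ (3 : ℝ) ≠ ⊤)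
    (hQ : ∀ φ : EuclideanSpace ℝ (Fin 3) → ℝ, ContDiff ℝ (⊤ : ℕ∞) φ → HasCompactSupport φ →
      ∫ y, Q y * (Δ φ) y = -∫ y, fderiv ℝ (fderiv ℝ φ) y (U y) (U y)) :
    ∃ c : ℝ, ∀ᵐ x ∂(volume : Measure (EuclideanSpace ℝ (Fin 3))), P x - Q x = c := by
  have hpq₃ : (3 : ℝ).HolderConjugate (3 / 2) := ⟨by norm_num, by norm_num, by norm_num⟩
  have hQl : LocallyIntegrable Q volume := locallyIntegrable_of_holder hQm hpq₃ hIQ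
  set g : EuclideanSpace ℝ (Fin 3) → ℝ := fun x => P x - Q x with hg_def
  have hgl : LocallyIntegrable g volume :=
    hprof.contDiff_pressure.continuous.locallyIntegrable.sub hQl
  obtain ⟨φ, hφ0, hφ2⟩ := FunctionSpaces.exists_contDiffBump_seq (E := (EuclideanSpace ℝ (Fin 3)))
  have hconst : ∀ k x, ((φ k).normed volume ⋆[lsmul ℝ ℝ, volume] g) x =
      ((φ k).normed volume ⋆[lsmul ℝ ℝ, volume] g) 0 := by
    intro k x
    have hdiff : Differentiable ℝ ((φ k).normed volume ⋆[lsmul ℝ ℝ, volume] g) :=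
      ((φ k).hasCompactSupport_normed.contDiff_convolution_left _
        ((φ k).contDiff_normed (n := 1)) hgl).differentiable one_ne_zero
    have hzero : ∀ y, fderiv ℝ ((φ k).normed volume ⋆[lsmul ℝ ℝ, volume] g) y = 0 := fun y => by
      ext e
      exact hprof.fderiv_normed_convolution_sub_eq_zero_six hM hIU hQm hIQ hQ (φ k) y e
    exact is_const_of_fderiv_eq_zero hdiff hzero x 0
  have hlim := FunctionSpaces.ae_tendsto_normed_convolution hφ0 hφ2 hgl
  refine ⟨limUnder atTop fun k => ((φ k).normed volume ⋆[lsmul ℝ ℝ, volume] g) 0, ?_⟩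
  filter_upwards [hlim] with x hx
  simp_rw [hconst _ x] at hx
  exact hx.limUnder_eq.symm

end PressureConstancy

/-! ## §5. The pressure limit at infinity -/

section PressureLimit

/-- **The pressure of a steady `D`-solution on `ℝ³` with `u → 0` has a limit at infinity — unit
viscosity** (Galdi 2011, Thm X.5.1 / Wang 2025, Thm 2.1, order-zero pressure clause, under the decay
hypothesis (0.2) of Leray's problem). Assembly of §§1–4: `u` is bounded, in `L⁶`, smooth with
bounded `Du`, `D²u`; the Calderón–Zygmund pressure `Q ∈ L³` differs from `p` by a constant `c`
a.e.; `∇p = Δu − (u·∇)u` is bounded, so `p − c` is Lipschitz with `∫|p − c|³ = ∫|Q|³ < ∞`, hence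
`p − c → 0` at infinity. [cite: Wang2025, Thm 2.1 (proof §2.1.3, pp. 30–31)] -/
theorem IsDSolution.exists_tendsto_pressure_one
    {u : EuclideanSpace ℝ (Fin 3) → EuclideanSpace ℝ (Fin 3)} {p : EuclideanSpace ℝ (Fin 3) → ℝ}
    (hu : IsDSolution 1 0 u p) (hdec : Tendsto u (cocompact (EuclideanSpace ℝ (Fin 3))) (𝓝 0)) :
    ∃ c : ℝ, Tendsto p (cocompact (EuclideanSpace ℝ (Fin 3))) (𝓝 c) := by
  have hS := hu.isSteadyNSSolution
  have hprof : IsLerayProfile 1 0 u p := hS.isLerayProfile_zero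
  have huc : Continuous u := hS.contDiff_velocity.continuous
  have hpc : Continuous p := hS.contDiff_pressure.continuous
  obtain ⟨M, hM⟩ := exists_forall_norm_le_of_tendsto_cocompact huc hdec
  have hM0 : 0 ≤ M := (norm_nonneg _).trans (hM 0)
  -- `u ∈ L⁶`
  have h6 : MemLp u 6 (volume : Measure (EuclideanSpace ℝ (Fin 3))) :=
    memLp_six_of_isDSolution_of_tendsto_zero hu hdec
  have hIU : ∫⁻ y, ‖u y‖ₑ ^ (6 : ℝ) ≠ ⊤ := by
    have h := h6.eLpNorm_lt_top
    rw [eLpNorm_lt_top_iff_lintegral_rpow_enorm_lt_top (by norm_num) (by norm_num)] at h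
    rw [show ((6 : ℝ≥0∞).toReal) = (6 : ℝ) by norm_num] at h
    exact h.ne
  -- the Calderón–Zygmund pressure `Q ∈ L³`
  obtain ⟨C, hC⟩ := nrs1996_rieszPressure_holds 3 (by norm_num)
  have hIU' : ∫⁻ y, ‖u y‖ₑ ^ (2 * (3 : ℝ)) < ⊤ := by
    rw [show (2 * (3 : ℝ)) = 6 by norm_num]
    exact lt_top_iff_ne_top.2 hIU
  obtain ⟨Q, hQm, hQle, hQ⟩ := hC huc.aestronglyMeasurable hIU'
  have hIQ : ∫⁻ y, ‖Q y‖ₑ ^ (3 : ℝ) ≠ ⊤ :=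
    ne_top_of_le_ne_top (ENNReal.mul_ne_top ENNReal.coe_ne_top hIU'.ne) hQle
  -- `p − Q = c` a.e.
  obtain ⟨c, hc⟩ := hprof.exists_sub_ae_eq_const_six hM hIU hQm hIQ hQ
  refine ⟨c, ?_⟩
  -- bounds on `Du`, `D²u`; `∇p = Δu − (u·∇)u` is bounded
  obtain ⟨K₁, hK₁⟩ := hS.exists_norm_iteratedFDeriv_le_of_tendsto_zero hdec 1
  obtain ⟨K₂, hK₂⟩ := hS.exists_norm_iteratedFDeriv_le_of_tendsto_zero hdec 2
  have hK₁0 : 0 ≤ K₁ := (norm_nonneg _).trans (hK₁ 0)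
  have hu2 : ContDiff ℝ 2 u := hS.contDiff_velocity
  set L : ℝ := 3 * K₂ + K₁ * M with hL_def
  have hgrad : ∀ x, ‖gradient p x‖ ≤ L := by
    intro x
    have h0 := hS.momentum x
    simp only [Pi.zero_apply, one_smul] at h0
    have e : gradient p x = (Δ u) x - convect u u x := by
      rw [← sub_eq_zero, ← h0]; abel
    rw [e]
    have hΔ : ‖(Δ u) x‖ ≤ 3 * K₂ :=
      (norm_laplacian_le_three_mul_norm_iteratedFDeriv_two hu2 x).trans
        (mul_le_mul_of_nonneg_left (hK₂ x) (by norm_num))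
    have hDu : ‖fderiv ℝ u x‖ ≤ K₁ := by
      have : ‖fderiv ℝ u x‖ = ‖iteratedFDeriv ℝ 1 u x‖ := by
        rw [← norm_iteratedFDeriv_zero (𝕜 := ℝ) (f := fderiv ℝ u) (x := x), norm_iteratedFDeriv_fderiv]
      rw [this]
      exact hK₁ x
    have hconv : ‖convect u u x‖ ≤ K₁ * M := by
      show ‖fderiv ℝ u x (u x)‖ ≤ K₁ * M
      exact (le_opNorm _ _).trans (mul_le_mul hDu (hM x) (norm_nonneg _) hK₁0)
    exact (norm_sub_le _ _).trans (add_le_add hΔ hconv)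
  have hL0 : 0 ≤ L := (norm_nonneg _).trans (hgrad 0)
  -- `p − c` is Lipschitz
  have hLip : LipschitzWith (Real.toNNReal L) (fun x => p x - c) := by
    refine lipschitzWith_of_nnnorm_fderiv_le
      ((hS.contDiff_pressure.differentiable one_ne_zero).sub_const c) fun x => ?_
    rw [fderiv_sub_const, ← NNReal.coe_le_coe, coe_nnnorm, Real.coe_toNNReal _ hL0]
    have hn : ‖fderiv ℝ p x‖ = ‖gradient p x‖ := by
      rw [gradient, LinearIsometryEquiv.norm_map]
    rw [hn]
    exact hgrad x
  -- `∫ |p − c|³ = ∫ |Q|³ < ∞`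
  have hint : Integrable (fun x => ‖p x - c‖ ^ 3) (volume : Measure (EuclideanSpace ℝ (Fin 3))) := by
    have hmeas : AEStronglyMeasurable (fun x => ‖p x - c‖ ^ 3)
        (volume : Measure (EuclideanSpace ℝ (Fin 3))) :=
      ((hpc.sub continuous_const).norm.pow 3).aestronglyMeasurable
    refine ⟨hmeas, ?_⟩
    rw [hasFiniteIntegral_iff_enorm]
    have hcongr : (fun x => ‖(‖p x - c‖ ^ 3)‖ₑ) =ᵐ[volume] fun x => ‖Q x‖ₑ ^ (3 : ℝ) := by
      filter_upwards [hc] with x hx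
      have hQx : p x - c = Q x := by linarith
      rw [hQx, Real.enorm_eq_ofReal (pow_nonneg (norm_nonneg _) _), ENNReal.ofReal_pow (norm_nonneg _),
        ofReal_norm, ← ENNReal.rpow_natCast]
      norm_num
    rw [lintegral_congr_ae hcongr]
    exact lt_top_iff_ne_top.2 hIQ
  have htend := tendsto_cocompact_of_lipschitzWith_of_integrable_pow hLip hint
  have h := htend.add_const c
  simpa using h

/-- **The pressure of a steady `D`-solution on `ℝ³` tending to `0` at infinity has a limit at
infinity, for every viscosity `ν > 0`** (Galdi 2011, Thm X.5.1 / Wang 2025, Thm 2.1, order-zero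
pressure clause, under exactly the hypotheses of Leray's Liouville problem
`GaldiLiouvilleGate.GaldiLiouville`): the UNCONDITIONAL twin of
`exists_tendsto_pressure_of_tendsto_zero` (`SobolevVanishingAtInfinity.lean`, which takes the named
fact `wang2025_thm21_DSolution_uniformDecay` as a hypothesis). The viscosity is normalised by
`(u, p) ↦ (ν⁻¹u, ν⁻²p)`. [cite: Wang2025, Thm 2.1 (proof §2.1.3, pp. 30–31)] -/
theorem IsDSolution.exists_tendsto_pressure {ν : ℝ} (hν : 0 < ν)
    {u : EuclideanSpace ℝ (Fin 3) → EuclideanSpace ℝ (Fin 3)} {p : EuclideanSpace ℝ (Fin 3) → ℝ}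
    (hu : IsDSolution ν 0 u p) (hdec : Tendsto u (cocompact (EuclideanSpace ℝ (Fin 3))) (𝓝 0)) :
    ∃ c : ℝ, Tendsto p (cocompact (EuclideanSpace ℝ (Fin 3))) (𝓝 c) := by
  have hν0 : ν ≠ 0 := hν.ne'
  -- normalise the viscosity
  have h1 : IsSteadyNSSolution 1 0 (ν⁻¹ • u) (ν⁻¹ ^ 2 • p) := by
    simpa using hu.isSteadyNSSolution.viscosity_one hν0
  have hud : Differentiable ℝ u :=
    hu.isSteadyNSSolution.contDiff_velocity.differentiable (by norm_num)
  have hfrob : ∀ y, frobeniusNormSq (fderiv ℝ (ν⁻¹ • u) y) =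
      (ν⁻¹) ^ 2 * frobeniusNormSq (fderiv ℝ u y) := by
    intro y
    rw [fderiv_const_smul (hud y) ν⁻¹]
    unfold frobeniusNormSq
    rw [Finset.mul_sum]
    refine Finset.sum_congr rfl fun i _ => ?_
    rw [_root_.smul_apply, norm_smul, mul_pow, Real.norm_eq_abs, sq_abs]
  have hD : (∫⁻ y, ENNReal.ofReal (frobeniusNormSq (fderiv ℝ (ν⁻¹ • u) y))) < ⊤ := by
    have e : (fun y => ENNReal.ofReal (frobeniusNormSq (fderiv ℝ (ν⁻¹ • u) y))) =
        fun y => ENNReal.ofReal ((ν⁻¹) ^ 2) * ENNReal.ofReal (frobeniusNormSq (fderiv ℝ u y)) := by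
      funext y; rw [hfrob y, ENNReal.ofReal_mul (sq_nonneg _)]
    rw [e, lintegral_const_mul' _ _ ENNReal.ofReal_ne_top]
    exact ENNReal.mul_lt_top ENNReal.ofReal_lt_top hu.dirichlet_lt_top
  have hD1 : IsDSolution 1 0 (ν⁻¹ • u) (ν⁻¹ ^ 2 • p) := ⟨h1, hD⟩
  have hdec1 : Tendsto (ν⁻¹ • u) (cocompact (EuclideanSpace ℝ (Fin 3))) (𝓝 0) := by
    have h := hdec.const_smul ν⁻¹
    rw [smul_zero] at h
    exact h
  obtain ⟨c, hc⟩ := hD1.exists_tendsto_pressure_one hdec1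
  refine ⟨ν ^ 2 * c, ?_⟩
  have h2 := hc.const_mul (ν ^ 2)
  refine h2.congr fun x => ?_
  simp only [Pi.smul_apply, smul_eq_mul]
  field_simp

/-- **The pressure limit of the Liouville-gate cylinder-budget lines — unconditional**: the
statement of `pressureLimit_of_uniformDecay` (`SteadyHeadPressureMaximumPrinciple.lean`) WITHOUT
its hypothesis `(hfact : wang2025_thm21_DSolution_uniformDecay)`: every smooth steady
`D`-solution `(U, P)` of the `ν`-system (`ν > 0`) with `U → 0` at infinity has a pressure limit
`P → c` at infinity (`IsDSolution.exists_tendsto_pressure`). [cite: Wang2025, Thm 2.1 (proof §2.1.3, pp. 30–31)] -/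
theorem pressureLimit_of_tendsto_zero :
    ∀ ν : ℝ, 0 < ν → ∀ (U : EuclideanSpace ℝ (Fin 3) → EuclideanSpace ℝ (Fin 3))
      (P : EuclideanSpace ℝ (Fin 3) → ℝ),
      (IsLerayProfile ν 0 U P ∧ ContDiff ℝ (⊤ : ℕ∞) U ∧ ContDiff ℝ (⊤ : ℕ∞) P ∧
        (∫⁻ y, ENNReal.ofReal (frobeniusNormSq (fderiv ℝ U y))) < ⊤ ∧
        Tendsto U (cocompact (EuclideanSpace ℝ (Fin 3))) (𝓝 0)) →
      ∃ c : ℝ, Tendsto P (cocompact (EuclideanSpace ℝ (Fin 3))) (𝓝 c) := by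
  rintro ν hν U P ⟨hprof, -, -, hD, hdec⟩
  have hDS : IsDSolution ν 0 U P := ⟨hprof.isSteadyNSSolution_zero, hD⟩
  exact hDS.exists_tendsto_pressure hν hdec

/-- **The allaxes obligation O1b `HeadMaximumPrinciple` — unconditional**: the statement of
`headMaximumPrinciple_of_uniformDecay` (`SteadyHeadPressureMaximumPrinciple.lean`) WITHOUT its
hypothesis `(hfact : wang2025_thm21_DSolution_uniformDecay)`: for every `ν > 0` and every smooth
steady solution with finite Dirichlet integral and `U → 0` at infinity (the hypotheses of
`GaldiLiouvilleGate.GaldiLiouville`, stmt-NavierStokesRegularity-0895), the pressure has a limit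
`c` at infinity (`IsDSolution.exists_tendsto_pressure`) and `P + |U|²/2 ≤ c` everywhere
(`headPressure_le_of_tendsto`, Chae–Weng 2016, Lemma 3.1). [cite: ChaeWeng2016, Lemma 3.1] -/
theorem headMaximumPrinciple_of_tendsto_zero :
    ∀ ν : ℝ, 0 < ν → ∀ (U : EuclideanSpace ℝ (Fin 3) → EuclideanSpace ℝ (Fin 3))
      (P : EuclideanSpace ℝ (Fin 3) → ℝ),
      (IsLerayProfile ν 0 U P ∧ ContDiff ℝ (⊤ : ℕ∞) U ∧ ContDiff ℝ (⊤ : ℕ∞) P ∧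
        (∫⁻ y, ENNReal.ofReal (frobeniusNormSq (fderiv ℝ U y))) < ⊤ ∧
        Tendsto U (cocompact (EuclideanSpace ℝ (Fin 3))) (𝓝 0)) →
      ∃ c : ℝ, Tendsto P (cocompact (EuclideanSpace ℝ (Fin 3))) (𝓝 c) ∧
        ∀ x, P x + ‖U x‖ ^ 2 / 2 ≤ c := by
  rintro ν hν U P ⟨hprof, hU, -, hD, hdec⟩
  have hDS : IsDSolution ν 0 U P := ⟨hprof.isSteadyNSSolution_zero, hD⟩
  obtain ⟨c, hc⟩ := hDS.exists_tendsto_pressure hν hdec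
  exact ⟨c, hc, headPressure_le_of_tendsto hν hprof hU hdec hc⟩

end PressureLimit

end Literature.Analysis.FluidPDE

end
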